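import Summits.BirchSwinnertonDyer.Rank1Residual.X11b.ShaAnBinderFromIndexRecord
import Summits.BirchSwinnertonDyer.Rank1Residual.X11b.SelmerSubgroupCertificate
import HarnessLib

/-!
# X11b at `p = 3` (and every odd `p`), the `p^j ∣ #Ш_an` rows: the `#Ш_an` binder `hs : shaAn W = s`
# of the LB3 / LB3SUB / LB3+KOLY roads DISCHARGED from the EXACT Gross–Zagier index record
# (cell `b2b-bsdres`, unit `x11b` gen 20; sibling of `ShaAnBinderFromIndexRecord.lean`, gen 19)

HONEST FRAMING (cell `b2b-bsdres`, run/shared/lean/b2b/bsd-rank1-residual/, verbatim in every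
file): the goal of the cell is to DELETE the COMBINATION-SHAPED residual classes of the
Birch–Swinnerton-Dyer formula for ALL analytic-rank `≤ 1` elliptic curves over `ℚ` — "full BSD
formula for every rank `≤ 1` curve in class `C`" assembled STRICTLY from published theorems — so
that the rank-`≤ 1` remainder becomes exactly the CONSTRUCTION-SHAPED classes, which are TYPED
(missing-input `Prop`s), NOT attempted. This is not "finishing BSD". X11b (multiplicative `p`,
`r = 1`) and X11 ∧ `r = 1` ∧ `p = 3` stay CONSTRUCTION-SHAPED (referee A R6.2). Per pair; research
route; nothing is booked by this file (the lane certifies, the referee books); no mark / label /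
count moves. THEOREMS ONLY (no definition, no named fact, no `sorry`): tree theorems are composed
in each declaration, nothing is re-proved.

## What the file does

Gen 19's `ShaAnBinderFromIndexRecord.lean` removed the binder `hq : shaAn W = (q : ℂ)` (with
`ord_p q = 0` / `≤ 0`) from the T-SELp / A1 / KOLY roads using multr1-p2's exact identity
`X11b.exists_shaAn_padicVal_eq_of_heegner` (Jetchev–Skinner–Wan 2017 (eq:gz for K′) + (eq:tamK)):
`ord_p #Ш(E)_an = 2·ord_p [E(K):ℤP] − ord_p q_d − ord_p ∏c_ℓ(E)` at a rank-one pair with `E[p]`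
irreducible (`P` the Heegner point of a parametrisation datum with `p ∤ c`, `K` Heegner with
`p ∤ #𝓞_K^×`, minimal twist model with `ord_p u = 0`, `q_d = L(E^{d_K},1)/Ω ∈ ℚ^×`). This file does
the same for the roads whose `#Ш_an` binder carries a POSITIVE exponent — `hs : shaAn W = (s : ℂ)`
with `ord_p s ≤ j` (atom A1 with a LOWER certificate: `AtomA1SelmerCertificate.lean`,
`SelmerSubgroupCertificate.lean`) or `ord_p s = 2` (Kolyvagin + lower certificate: `SelmerRankOne.lean`):

* §1 (class-free, any odd `p`, `E[p]` irreducible): the record INEQUALITY (resp. EQUATION)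
  `2·ord_p I ≤ j + ord_p q_d + ord_p ∏c_ℓ` gives `#Ш(E)_an = q ∈ ℚ` with `ord_p q ≤ j` (resp. `= j`);
  the Heegner point is non-torsion when `r_an(E) = 1` and `q_d ≠ 0` (Gross–Zagier).
* §2 (KOLY + LOWER certificate, class-free, any odd `p`, `ρ̄_{E,p}` onto)
  `bsdp_of_kolyvagin_of_card_selmer_of_indexRecord`: Kolyvagin's index certificate
  `ord_p [E(K):ℤP] ≤ 1`, the record equation `2·ord_p [E(K):ℤP] = 2 + ord_p q_d + ord_p ∏c_ℓ` and ONE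
  exact `p`-descent `#Sel^(p)(E/ℚ) = p³` ⇒ `BSD(E,p)` — NO `hs`.
* §3 (conductor level, X11b vocabulary, `w_K = 2` from `d_K < −4`, `ord_p u = 0` from `p ‖ N` split
  in `K`): `ClassX11b.exists_shaAn_padicValRat_le_of_not_dvd_of_indexRecord_le` (atom: `p ∤ ∏c_ℓ`),
  `ClassX11b.bsdp_of_ram_of_not_dvd_of_pow_dvd_of_indexRecord_le` (A1 ∧ ANY lower certificate
  `p^j ∣ #Ш(E/ℚ)` ∧ record `2·ord_p [E(K):ℤP] ≤ j + ord_p q_d` ⇒ `BSD(E,p)`), and the KOLY twin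
  `ClassX11b.bsdp_of_kolyvagin_of_card_selmer_of_indexRecord` (`ρ̄` onto displayed).
* §4 (`p = 3`, `IsX11Three` / `ClassX11b W 3` vocabulary): the LB3 row shape (EXACT `#Sel₃ = 27`),
  the LB3SUB row shape (exhibited subgroup of order `27`), the LB3+KOLY row shape
  (`ord₃ [E(K):ℤP] ≤ 1`), each with the record in place of `hs`/`hv`.

WHAT THIS FILE DOES NOT DO: decide the admissibility of `q_d`, of the index, or of the Manin
constant of the datum as certificate inputs (referee A; only `p ∤ c(Dt)` is a binder — Mazur 1978
Cor. 4.1, `p² ∤ 4N`, is the printed reason it holds for the optimal parametrisation at `3 ‖ N`),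
certify any record, book any pair, or touch a label. EVIDENCE pointers (lane data, nothing
asserted; `HOME/b2b-bsdres-x11b/g19/INDEX_RECORD_TABLE.tsv`): of the 79 `#Ш_an = 9` classes of the
lane's X11b@3 rank-one residue at `N < 5·10⁵`, 68 lie on the atom A1 with `2·ord₃ I_K = 2 + ord₃ q_d`
at the field of record (38 with an EXACT `#Sel₃ = 27`, 30 with an exhibited subgroup of order `27`),
6 have no (ram) prime but `ρ̄_{E,3}` onto, `ord₃ I_K = 1`, `ord₃ q_d = 0 = v₃(∏c_ℓ)` and an EXACT
`#Sel₃ = 27`; the 5 remaining are the (T2′) classes (`3 ∣ ∏c_ℓ`), not reached here.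

References: [JetchevSkinnerWan2017] §7.3.1, §7.4; [GrossZagier1986] I.(6.3), V.§2; [Gross1991] (1.1);
[McCallumLMS1991] §1; [GrossLMS1991] Thm. 1.3; [Skinner2016PacificMC] Thm. C; [Mazur1978] Cor. 4.1;
[SilvermanAEC2009] X.4.2; [SchaeferStoll2004] §1, §5; [Miller2011LMS] §1, Def. 1.1. -/

noncomputable section

open scoped Classical

open WeierstrassCurve NumberField Literature.NumberTheory.EllipticCurves
  Literature.NumberTheory.EllipticCurves.ModularForms
  Literature.NumberTheory.EllipticCurves.Rank1Residual
  Literature.NumberTheory.EllipticCurves.Rank1Residual.Typed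
  Literature.NumberTheory.EllipticCurves.KrizLi2019
  Literature.NumberTheory.QuadraticFields

namespace Summit.BirchSwinnertonDyer.Rank1Residual.X11b

/-! ### §1. `ord_p #Ш(E)_an ≤ j` / `= j` from the exact index record (class-free, any odd `p`) -/

section Record

variable (W : WeierstrassCurve ℚ) [W.IsElliptic] [W.IsGloballyMinimal] (p : ℕ) [Fact p.Prime]
  (N : ℕ) [NeZero N] (K : Type) [Field K] [NumberField K]
  (Dt : ModularParametrizationData W N) (H : HeegnerDatum N (NumberField.discr K)) (ι : K →+* ℂ)
  (P : (W.baseChange K).toAffine.Point)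

/-- **The record INEQUALITY with a positive exponent**: data as in
`exists_shaAn_padicValRat_eq_of_heegner_of_irr` (rank one, `p` odd, `E[p]` irreducible, Heegner datum
with `p ∤ c(Dt)`, `p ∤ #𝓞_K^×`, minimal twist model with `ord_p u = 0`, `q_d ≠ 0`); the record satisfies
`2·ord_p [E(K):ℤP] ≤ j + ord_p q_d + ord_p ∏_ℓ c_ℓ(E)` ⇒ `#Ш(E)_an = q ∈ ℚ` with `ord_p q ≤ j` — the pair
`(hs, hv)` of the A1 consumers with a lower certificate. Per pair; nothing booked.
[cite: JetchevSkinnerWan2017, §7.4.1 (eq:gz for K′), pp. 29–30] [cite: Miller2011LMS, §1 and Def. 1.1] -/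
theorem exists_shaAn_padicValRat_le_of_indexRecord_le
    (hGZ : gross_zagier N W K) (hKo : kolyvagin N W K)
    (hGZK : rank_eq_analyticRank_of_analyticRank_le_one) (hmod : hasEntireLFunction_rat)
    (hK : IsImaginaryQuadratic K) (hHN : SatisfiesHeegnerHypothesis N K)
    (hP : WeierstrassCurve.Affine.Point.map ι.toRatAlgHom P = heegnerPointComplex Dt H)
    (hp2 : p ≠ 2) (hc : ¬ (p : ℤ) ∣ Dt.c) (hμ : ¬ p ∣ Units.torsionOrder K)
    (hr : W.analyticRank = 1) (hirr : Irr W p)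
    (Wd : WeierstrassCurve ℚ) [Wd.IsElliptic] [Wd.IsGloballyMinimal] (Cd : VariableChange ℚ)
    (hWd : Cd • W.quadraticTwist (NumberField.discr K : ℚ) = Wd)
    (hu : padicValRat p (Cd.u : ℚ) = 0)
    (qd : ℚ) (hqd : Wd.entireLFunction 1 / (Wd.realPeriodRat : ℂ) = (qd : ℂ)) (hqd0 : qd ≠ 0)
    {j : ℕ} (hrec : 2 * (padicValNat p (AddSubgroup.zmultiples P).index : ℤ) ≤
      j + padicValRat p qd + padicValNat p W.tamagawaProduct) :
    ∃ q : ℚ, shaAn W = (q : ℂ) ∧ padicValRat p q ≤ j := by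
  obtain ⟨q, hq, hv⟩ := exists_shaAn_padicValRat_eq_of_heegner_of_irr W p N K Dt H ι P hGZ hKo hGZK
    hmod hK hHN hP hp2 hc hμ hr hirr Wd Cd hWd hu qd hqd hqd0
  exact ⟨q, hq, by rw [hv]; linarith⟩

omit [W.IsGloballyMinimal] in
/-- **The Heegner point of the record is non-torsion** when `ord_{s=1} L(E,s) = 1` and `q_d ≠ 0`:
`L'(E/K,1) = L'(E,1)·L(E^{d_K},1) ≠ 0` and Gross–Zagier (`lDerivEK_ne_zero_iff_not_isOfFinAddOrder`;
the step additive-p1 performs inside `AdditivePotMult.bsdp_of_rankOne_of_indexCertificate`). Per pair.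
[cite: GrossZagier1986, Thm. I.(6.3) with V.§2] [cite: Gross1991, (1.1)] -/
theorem not_isOfFinAddOrder_heegner_of_rankOne_of_twist
    (hGZ : gross_zagier N W K) (hmod : hasEntireLFunction_rat)
    (hK : IsImaginaryQuadratic K) (hHN : SatisfiesHeegnerHypothesis N K)
    (hP : WeierstrassCurve.Affine.Point.map ι.toRatAlgHom P = heegnerPointComplex Dt H)
    (hr : W.analyticRank = 1)
    (Wd : WeierstrassCurve ℚ) [Wd.IsElliptic] (Cd : VariableChange ℚ)
    (hWd : Cd • W.quadraticTwist (NumberField.discr K : ℚ) = Wd)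
    (qd : ℚ) (hqd : Wd.entireLFunction 1 / (Wd.realPeriodRat : ℂ) = (qd : ℂ)) (hqd0 : qd ≠ 0) :
    ¬ IsOfFinAddOrder P := by
  have hD0 : (NumberField.discr K : ℚ) ≠ 0 := by exact_mod_cast NumberField.discr_ne_zero K
  haveI hEt : (W.quadraticTwist (NumberField.discr K : ℚ)).IsElliptic :=
    W.isElliptic_quadraticTwist hD0
  have hLt' : (W.quadraticTwist (NumberField.discr K : ℚ)).entireLFunction = Wd.entireLFunction := by
    rw [← hWd, entireLFunction_smul]
  have hLt : (W.quadraticTwist (NumberField.discr K : ℚ)).entireLFunction 1 ≠ 0 := by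
    rw [hLt']
    intro h0
    apply hqd0
    have : ((qd : ℂ)) = 0 := by rw [← hqd, h0, zero_div]
    exact_mod_cast this
  have hPH : IsHeegnerPoint N W K P := ⟨Dt, H, ι, hP⟩
  have hL0 : W.entireLFunction 1 = 0 := entireLFunction_one_eq_zero_of_analyticRank_eq_one hr
  obtain ⟨-, hderiv⟩ := leadingLCoeff_eq_deriv_of_analyticRank_eq_one hr
  have hLK : LDerivEK W K ≠ 0 := by
    rw [lDerivEK_eq_deriv_mul W K hmod hL0]
    exact mul_ne_zero hderiv hLt
  exact (lDerivEK_ne_zero_iff_not_isOfFinAddOrder W N K hGZ hK hHN hPH).mp hLK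

/-! ### §2. Kolyvagin + a LOWER certificate without `hs` (class-free, any odd `p`, `ρ̄` onto) -/

/-- **Rank one, odd `p`, `ρ̄_{E,p}` onto: `BSD(E,p)` from PUBLISHED theorems, Kolyvagin's index
certificate `ord_p [E(K):ℤP] ≤ 1`, the exact index record with `2·ord_p [E(K):ℤP] = 2 + ord_p q_d +
ord_p ∏_ℓ c_ℓ(E)` (so `ord_p #Ш(E)_an = 2`), and ONE exact `p`-descent `#Sel^(p)(E/ℚ) = p³`** —
`bsdp_of_kolyvagin_of_card_selmer` (`SelmerRankOne.lean`) with its binders `hs`/`hv : ord_p s = 2`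
REPLACED by the record (`P` = the Heegner point of the datum, non-torsion by §1). PUBLISHED binders
`hGZ`, `hKo` + McCallum's bound `hB`, `hGZK`, `hmod`. Per pair; NOT a class theorem; nothing booked.
[cite: McCallumLMS1991, §1 Theorem (Kolyvagin), p. 296] [cite: GrossLMS1991, §1 Thm. 1.3 (2), p. 236]
[cite: JetchevSkinnerWan2017, §7.4.1 (eq:gz for K′), pp. 29–30] [cite: Miller2011LMS, §1 and Def. 1.1] -/
theorem bsdp_of_kolyvagin_of_card_selmer_of_indexRecord
    (hGZ : gross_zagier N W K) (hKo : kolyvagin N W K)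
    (hB : Kolyvagin1990_padicValNat_card_sha_le N W K)
    (hGZK : rank_eq_analyticRank_of_analyticRank_le_one) (hmod : hasEntireLFunction_rat)
    (hK : IsImaginaryQuadratic K) (hHN : SatisfiesHeegnerHypothesis N K)
    (hP : WeierstrassCurve.Affine.Point.map ι.toRatAlgHom P = heegnerPointComplex Dt H)
    (hp2 : p ≠ 2) (hc : ¬ (p : ℤ) ∣ Dt.c) (hμ : ¬ p ∣ Units.torsionOrder K)
    (hr : W.analyticRank = 1) (hρ : Surj W p)
    (Wd : WeierstrassCurve ℚ) [Wd.IsElliptic] [Wd.IsGloballyMinimal] (Cd : VariableChange ℚ)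
    (hWd : Cd • W.quadraticTwist (NumberField.discr K : ℚ) = Wd)
    (hu : padicValRat p (Cd.u : ℚ) = 0)
    (qd : ℚ) (hqd : Wd.entireLFunction 1 / (Wd.realPeriodRat : ℂ) = (qd : ℂ)) (hqd0 : qd ≠ 0)
    (hI : padicValNat p (AddSubgroup.zmultiples P).index ≤ 1)
    (hrec : 2 * (padicValNat p (AddSubgroup.zmultiples P).index : ℤ) =
      2 + padicValRat p qd + padicValNat p W.tamagawaProduct)
    (hcard : Nat.card (W.selmerGroup (p : ℤ)) = p ^ 3) :
    BSDp W p := by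
  have hirr : Irr W p := hasIrreducibleModPGaloisRep_of_hasSurjectiveModNGaloisRep W p hρ
  obtain ⟨q, hq, hv⟩ := exists_shaAn_padicValRat_eq_of_heegner_of_irr W p N K Dt H ι P hGZ hKo hGZK
    hmod hK hHN hP hp2 hc hμ hr hirr Wd Cd hWd hu qd hqd hqd0
  have hnt : ¬ IsOfFinAddOrder P :=
    not_isOfFinAddOrder_heegner_of_rankOne_of_twist W N K Dt H ι P hGZ hmod hK hHN hP hr Wd Cd hWd qd
      hqd hqd0
  exact bsdp_of_kolyvagin_of_card_selmer W p hGZK hKo hB hK hHN ⟨Dt, H, ι, hP⟩ hnt hp2 hρ hI hr hq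
    (by rw [hv]; linarith) hcard

end Record

/-! ### §3. Conductor level (X11b): the atom A1 with a LOWER certificate, and the KOLY twin -/

section Conductor

variable (W : WeierstrassCurve ℚ) [W.IsElliptic] [W.IsGloballyMinimal] (p : ℕ) [Fact p.Prime]
  [NeZero (W.conductorNorm ℤ)] (K : Type) [Field K] [NumberField K]
  (Dt : ModularParametrizationData W (W.conductorNorm ℤ))
  (H : HeegnerDatum (W.conductorNorm ℤ) (NumberField.discr K)) (ι : K →+* ℂ)
  (P : (W.baseChange K).toAffine.Point)

/-- **X11b with `p ∤ ∏c_ℓ(E)` at a Heegner field with `d_K < −4`: the record inequality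
`2·ord_p [E(K):ℤP] ≤ j + ord_p q_d` gives `#Ш(E)_an = q ∈ ℚ` with `ord_p q ≤ j`.** §1 at the conductor
level: `p ∤ w_K = 2` (`X2.not_dvd_unitsTorsionOrder_of_discr_lt`), `ord_p u(Cd) = 0` because `p ‖ N`
splits in `K` (`padicValRat_u_eq_zero_of_twist_minimal`), and the Tamagawa term vanishes. PUBLISHED
binders `hGZ`, `hKo`, `hGZK`, `hmod`; the Manin binder `p ∤ c(Dt)` stays displayed. Per pair.
[cite: JetchevSkinnerWan2017, §7.4.1 (eq:gz for K′), pp. 29–30] [cite: Miller2011LMS, §1 and Def. 1.1] -/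
theorem ClassX11b.exists_shaAn_padicValRat_le_of_not_dvd_of_indexRecord_le
    (hGZ : gross_zagier (W.conductorNorm ℤ) W K) (hKo : kolyvagin (W.conductorNorm ℤ) W K)
    (hGZK : rank_eq_analyticRank_of_analyticRank_le_one) (hmod : hasEntireLFunction_rat)
    (hX : ClassX11b W p) (htam0 : ¬ p ∣ W.tamagawaProduct)
    (hK : IsImaginaryQuadratic K) (hdK : NumberField.discr K < -4)
    (hHN : SatisfiesHeegnerHypothesis (W.conductorNorm ℤ) K)
    (hP : WeierstrassCurve.Affine.Point.map ι.toRatAlgHom P = heegnerPointComplex Dt H)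
    (hc : ¬ (p : ℤ) ∣ Dt.c)
    (Wd : WeierstrassCurve ℚ) [Wd.IsElliptic] [Wd.IsGloballyMinimal] (Cd : VariableChange ℚ)
    (hWd : Cd • W.quadraticTwist (NumberField.discr K : ℚ) = Wd)
    (qd : ℚ) (hqd : Wd.entireLFunction 1 / (Wd.realPeriodRat : ℂ) = (qd : ℂ)) (hqd0 : qd ≠ 0)
    {j : ℕ} (hrec : 2 * (padicValNat p (AddSubgroup.zmultiples P).index : ℤ) ≤ j + padicValRat p qd) :
    ∃ q : ℚ, shaAn W = (q : ℂ) ∧ padicValRat p q ≤ j := by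
  obtain ⟨hr, hp2, hmult, hirr⟩ := hX
  have hμ : ¬ p ∣ Units.torsionOrder K := X2.not_dvd_unitsTorsionOrder_of_discr_lt hK hdK Fact.out hp2
  have hu : padicValRat p (Cd.u : ℚ) = 0 :=
    padicValRat_u_eq_zero_of_twist_minimal W p K hK hHN hmult Cd hWd
  have htam : padicValNat p W.tamagawaProduct = 0 := padicValNat.eq_zero_of_not_dvd htam0
  exact exists_shaAn_padicValRat_le_of_indexRecord_le W p (W.conductorNorm ℤ) K Dt H ι P hGZ hKo hGZK
    hmod hK hHN hP hp2 hc hμ hr hirr Wd Cd hWd hu qd hqd hqd0 (j := j)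
    (by rw [htam, Nat.cast_zero, add_zero]; exact hrec)

/-- **X11b ∧ (ram) ∧ `p ∤ ∏c_ℓ`, EVERY ODD PRIME, ANY lower certificate `p^j ∣ #Ш(E/ℚ)`: `BSD(E,p)`
from the ten PUBLISHED facts of the A1 road, that certificate, and the exact index record with
`2·ord_p [E(K):ℤP] ≤ j + ord_p q_d`** — `bsdp_of_classX11b_of_ram_of_not_dvd_of_pow_dvd`
(`AtomA1SelmerCertificate.lean`: UPPER half unconditional on the atom, Kolyvagin Thm. A at the
Hoffstein–Luo / Manin-good datum against Skinner 2016 Thm. C for the twist) with `hs`/`hv` REPLACED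
by the record. PUBLISHED binders `hGZ hKo hB hSk hGZK hmod hnf hHL hMaz hNS`. Per pair; nothing booked.
[cite: JetchevSkinnerWan2017, §7.4.2 (p. 31)] [cite: McCallumLMS1991, §1 Theorem (Kolyvagin), p. 296]
[cite: Skinner2016PacificMC, Thm. C (§1) and footnote 1] [cite: Miller2011LMS, §1 and Def. 1.1] -/
theorem ClassX11b.bsdp_of_ram_of_not_dvd_of_pow_dvd_of_indexRecord_le
    (hGZ : ∀ (N : ℕ) [NeZero N] (W : WeierstrassCurve ℚ) (K : Type) [Field K] [NumberField K],
      gross_zagier N W K)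
    (hKo : ∀ (N : ℕ) [NeZero N] (W : WeierstrassCurve ℚ) (K : Type) [Field K] [NumberField K],
      kolyvagin N W K)
    (hB : ∀ (N : ℕ) [NeZero N] (W : WeierstrassCurve ℚ) (K : Type) [Field K] [NumberField K],
      Kolyvagin1990_padicValNat_card_sha_le N W K)
    (hSk : Skinner2016.thmC_padicValRat_bsd_rank_zero)
    (hGZK : rank_eq_analyticRank_of_analyticRank_le_one) (hmod : hasEntireLFunction_rat)
    (hnf : exists_isNewformOf) (hHL : HoffsteinLuo1997_exists_twist_L_one_ne_zero)
    (hMaz : mazur_not_dvd_maninConstant_of_odd) (hNS : integral_neronScaling_of_isGloballyMinimal)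
    (hX : ClassX11b W p) (hram : Ram W p) (htam0 : ¬ p ∣ W.tamagawaProduct)
    (hK : IsImaginaryQuadratic K) (hdK : NumberField.discr K < -4)
    (hHN : SatisfiesHeegnerHypothesis (W.conductorNorm ℤ) K)
    (hP : WeierstrassCurve.Affine.Point.map ι.toRatAlgHom P = heegnerPointComplex Dt H)
    (hc : ¬ (p : ℤ) ∣ Dt.c)
    (Wd : WeierstrassCurve ℚ) [Wd.IsElliptic] [Wd.IsGloballyMinimal] (Cd : VariableChange ℚ)
    (hWd : Cd • W.quadraticTwist (NumberField.discr K : ℚ) = Wd)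
    (qd : ℚ) (hqd : Wd.entireLFunction 1 / (Wd.realPeriodRat : ℂ) = (qd : ℂ)) (hqd0 : qd ≠ 0)
    {j : ℕ} (hdvd : p ^ j ∣ W.shaOrder)
    (hrec : 2 * (padicValNat p (AddSubgroup.zmultiples P).index : ℤ) ≤ j + padicValRat p qd) :
    BSDp W p := by
  obtain ⟨q, hq, hv⟩ := ClassX11b.exists_shaAn_padicValRat_le_of_not_dvd_of_indexRecord_le W p K Dt H
    ι P (hGZ _ W K) (hKo _ W K) hGZK hmod hX htam0 hK hdK hHN hP hc Wd Cd hWd qd hqd hqd0 hrec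
  exact bsdp_of_classX11b_of_ram_of_not_dvd_of_pow_dvd hGZ hKo hB hSk hGZK hmod hnf hHL hMaz hNS W p hX
    hram htam0 hdvd hq hv

/-- **X11b with `ρ̄_{E,p}` onto, EVERY ODD PRIME: `BSD(E,p)` from Kolyvagin's index certificate
`ord_p [E(K):ℤP] ≤ 1` at a Heegner field with `d_K < −4`, the record equation
`2·ord_p [E(K):ℤP] = 2 + ord_p q_d + ord_p ∏_ℓ c_ℓ(E)`, and ONE exact `p`-descent `#Sel^(p)(E/ℚ) = p³`**
— §2 at the conductor level (`w_K`, `u` discharged); `ρ̄` onto DISPLAYED (no (ram) prime assumed):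
`ClassX11b.bsdp_of_kolyvagin_of_card_selmer` without `hs`/`hv`. Per pair; nothing booked.
[cite: McCallumLMS1991, §1 Theorem (Kolyvagin), p. 296]
[cite: JetchevSkinnerWan2017, §7.4.1 (eq:gz for K′), pp. 29–30] [cite: Miller2011LMS, §1 and Def. 1.1] -/
theorem ClassX11b.bsdp_of_kolyvagin_of_card_selmer_of_indexRecord
    (hGZ : gross_zagier (W.conductorNorm ℤ) W K) (hKo : kolyvagin (W.conductorNorm ℤ) W K)
    (hB : Kolyvagin1990_padicValNat_card_sha_le (W.conductorNorm ℤ) W K)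
    (hGZK : rank_eq_analyticRank_of_analyticRank_le_one) (hmod : hasEntireLFunction_rat)
    (hX : ClassX11b W p) (hρ : Surj W p)
    (hK : IsImaginaryQuadratic K) (hdK : NumberField.discr K < -4)
    (hHN : SatisfiesHeegnerHypothesis (W.conductorNorm ℤ) K)
    (hP : WeierstrassCurve.Affine.Point.map ι.toRatAlgHom P = heegnerPointComplex Dt H)
    (hc : ¬ (p : ℤ) ∣ Dt.c)
    (Wd : WeierstrassCurve ℚ) [Wd.IsElliptic] [Wd.IsGloballyMinimal] (Cd : VariableChange ℚ)
    (hWd : Cd • W.quadraticTwist (NumberField.discr K : ℚ) = Wd)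
    (qd : ℚ) (hqd : Wd.entireLFunction 1 / (Wd.realPeriodRat : ℂ) = (qd : ℂ)) (hqd0 : qd ≠ 0)
    (hI : padicValNat p (AddSubgroup.zmultiples P).index ≤ 1)
    (hrec : 2 * (padicValNat p (AddSubgroup.zmultiples P).index : ℤ) =
      2 + padicValRat p qd + padicValNat p W.tamagawaProduct)
    (hcard : Nat.card (W.selmerGroup (p : ℤ)) = p ^ 3) :
    BSDp W p := by
  obtain ⟨hr, hp2, hmult, -⟩ := hX
  have hμ : ¬ p ∣ Units.torsionOrder K := X2.not_dvd_unitsTorsionOrder_of_discr_lt hK hdK Fact.out hp2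
  have hu : padicValRat p (Cd.u : ℚ) = 0 :=
    padicValRat_u_eq_zero_of_twist_minimal W p K hK hHN hmult Cd hWd
  exact X11b.bsdp_of_kolyvagin_of_card_selmer_of_indexRecord W p (W.conductorNorm ℤ) K Dt H ι P hGZ hKo hB
    hGZK hmod hK hHN hP hp2 hc hμ hr hρ Wd Cd hWd hu qd hqd hqd0 hI hrec hcard

end Conductor

/-! ### §4. The `p = 3` rows (`IsX11Three` / `ClassX11b W 3`): LB3, LB3SUB, LB3+KOLY -/

section Three

variable (W : WeierstrassCurve ℚ) [W.IsElliptic] [W.IsGloballyMinimal] [NeZero (W.conductorNorm ℤ)]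
  (K : Type) [Field K] [NumberField K] (Dt : ModularParametrizationData W (W.conductorNorm ℤ))
  (H : HeegnerDatum (W.conductorNorm ℤ) (NumberField.discr K)) (ι : K →+* ℂ)
  (P : (W.baseChange K).toAffine.Point)

/-- **The LB3 rows on the atom A1 at `p = 3` (`IsX11Three` ∧ (ram) ∧ `3 ∤ ∏c_ℓ`): EXACT `#Sel^(3)(E/ℚ)
= 27` and the exact index record with `2·ord₃ [E(K):ℤP] ≤ 2 + ord₃ q_d` at a Heegner field with
`d_K < −4` ⇒ `BSD(E,3)`** — `IsX11Three.bsdp_of_ram_of_not_dvd_of_card_selmerThree_eq` with its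
binders `hs`/`hv : ord₃ s ≤ 2` REPLACED by the record (ten PUBLISHED facts of the A1 road; the Manin
binder `3 ∤ c(Dt)` displayed). Per pair; X11 ∧ `r = 1` ∧ `p = 3` stays CONSTRUCTION-SHAPED.
[cite: JetchevSkinnerWan2017, §7.4.2 (p. 31)] [cite: McCallumLMS1991, §1 Theorem (Kolyvagin), p. 296]
[cite: Skinner2016PacificMC, Thm. C (§1) and footnote 1] [cite: Miller2011LMS, §1 and Def. 1.1] -/
theorem IsX11Three.bsdp_of_ram_of_not_dvd_of_card_selmerThree_eq_of_indexRecord_le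
    (hGZ : ∀ (N : ℕ) [NeZero N] (W : WeierstrassCurve ℚ) (K : Type) [Field K] [NumberField K],
      gross_zagier N W K)
    (hKo : ∀ (N : ℕ) [NeZero N] (W : WeierstrassCurve ℚ) (K : Type) [Field K] [NumberField K],
      kolyvagin N W K)
    (hB : ∀ (N : ℕ) [NeZero N] (W : WeierstrassCurve ℚ) (K : Type) [Field K] [NumberField K],
      Kolyvagin1990_padicValNat_card_sha_le N W K)
    (hSk : Skinner2016.thmC_padicValRat_bsd_rank_zero)
    (hGZK : rank_eq_analyticRank_of_analyticRank_le_one) (hmod : hasEntireLFunction_rat)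
    (hnf : exists_isNewformOf) (hHL : HoffsteinLuo1997_exists_twist_L_one_ne_zero)
    (hMaz : mazur_not_dvd_maninConstant_of_odd) (hNS : integral_neronScaling_of_isGloballyMinimal)
    (hX : IsX11Three W) (hram : Ram W 3) (htam0 : ¬ 3 ∣ W.tamagawaProduct)
    (hK : IsImaginaryQuadratic K) (hdK : NumberField.discr K < -4)
    (hHN : SatisfiesHeegnerHypothesis (W.conductorNorm ℤ) K)
    (hP : WeierstrassCurve.Affine.Point.map ι.toRatAlgHom P = heegnerPointComplex Dt H)
    (hc : ¬ (3 : ℤ) ∣ Dt.c)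
    (Wd : WeierstrassCurve ℚ) [Wd.IsElliptic] [Wd.IsGloballyMinimal] (Cd : VariableChange ℚ)
    (hWd : Cd • W.quadraticTwist (NumberField.discr K : ℚ) = Wd)
    (qd : ℚ) (hqd : Wd.entireLFunction 1 / (Wd.realPeriodRat : ℂ) = (qd : ℂ)) (hqd0 : qd ≠ 0)
    (hcard : Nat.card (W.selmerGroup (3 : ℤ)) = 27)
    (hrec : 2 * (padicValNat 3 (AddSubgroup.zmultiples P).index : ℤ) ≤ 2 + padicValRat 3 qd) :
    BSDp W 3 := by
  obtain ⟨q, hq, hv⟩ := ClassX11b.exists_shaAn_padicValRat_le_of_not_dvd_of_indexRecord_le W 3 K Dt H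
    ι P (hGZ _ W K) (hKo _ W K) hGZK hmod (classX11b_three_of_isX11Three W hX) htam0 hK hdK hHN hP
    (by exact_mod_cast hc) Wd Cd hWd qd hqd hqd0 (j := 2) (by exact_mod_cast hrec)
  exact IsX11Three.bsdp_of_ram_of_not_dvd_of_card_selmerThree_eq hGZ hKo hB hSk hGZK hmod hnf hHL hMaz
    hNS W hX hram htam0 hcard hq (by exact_mod_cast hv)

/-- **The LB3SUB rows on the atom A1 at `p = 3`: an EXHIBITED subgroup of `Sel^(3)(E/ℚ)` of order
`27` (three independent `3`-Selmer classes verified by local images — no `bnfcertify`, no GRH) and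
the exact index record with `2·ord₃ [E(K):ℤP] ≤ 2 + ord₃ q_d` ⇒ `BSD(E,3)`** —
`IsX11Three.bsdp_of_ram_of_not_dvd_of_card_addSubgroup_selmerThree_eq` with `hs`/`hv` REPLACED by the
record. Per pair; X11 ∧ `r = 1` ∧ `p = 3` stays CONSTRUCTION-SHAPED; nothing booked.
[cite: JetchevSkinnerWan2017, §7.4.2 (p. 31)] [cite: McCallumLMS1991, §1 Theorem (Kolyvagin), p. 296]
[cite: SchaeferStoll2004, §1 and §5] [cite: Miller2011LMS, §1 and Def. 1.1] -/
theorem IsX11Three.bsdp_of_ram_of_not_dvd_of_card_addSubgroup_selmerThree_eq_of_indexRecord_le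
    (hGZ : ∀ (N : ℕ) [NeZero N] (W : WeierstrassCurve ℚ) (K : Type) [Field K] [NumberField K],
      gross_zagier N W K)
    (hKo : ∀ (N : ℕ) [NeZero N] (W : WeierstrassCurve ℚ) (K : Type) [Field K] [NumberField K],
      kolyvagin N W K)
    (hB : ∀ (N : ℕ) [NeZero N] (W : WeierstrassCurve ℚ) (K : Type) [Field K] [NumberField K],
      Kolyvagin1990_padicValNat_card_sha_le N W K)
    (hSk : Skinner2016.thmC_padicValRat_bsd_rank_zero)
    (hGZK : rank_eq_analyticRank_of_analyticRank_le_one) (hmod : hasEntireLFunction_rat)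
    (hnf : exists_isNewformOf) (hHL : HoffsteinLuo1997_exists_twist_L_one_ne_zero)
    (hMaz : mazur_not_dvd_maninConstant_of_odd) (hNS : integral_neronScaling_of_isGloballyMinimal)
    (hX : IsX11Three W) (hram : Ram W 3) (htam0 : ¬ 3 ∣ W.tamagawaProduct)
    (hK : IsImaginaryQuadratic K) (hdK : NumberField.discr K < -4)
    (hHN : SatisfiesHeegnerHypothesis (W.conductorNorm ℤ) K)
    (hP : WeierstrassCurve.Affine.Point.map ι.toRatAlgHom P = heegnerPointComplex Dt H)
    (hc : ¬ (3 : ℤ) ∣ Dt.c)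
    (Wd : WeierstrassCurve ℚ) [Wd.IsElliptic] [Wd.IsGloballyMinimal] (Cd : VariableChange ℚ)
    (hWd : Cd • W.quadraticTwist (NumberField.discr K : ℚ) = Wd)
    (qd : ℚ) (hqd : Wd.entireLFunction 1 / (Wd.realPeriodRat : ℂ) = (qd : ℂ)) (hqd0 : qd ≠ 0)
    {S : AddSubgroup (W.galH1Torsion (3 : ℤ))} (hS : S ≤ W.selmerGroup (3 : ℤ))
    (hcardS : Nat.card S = 27)
    (hrec : 2 * (padicValNat 3 (AddSubgroup.zmultiples P).index : ℤ) ≤ 2 + padicValRat 3 qd) :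
    BSDp W 3 := by
  obtain ⟨q, hq, hv⟩ := ClassX11b.exists_shaAn_padicValRat_le_of_not_dvd_of_indexRecord_le W 3 K Dt H
    ι P (hGZ _ W K) (hKo _ W K) hGZK hmod (classX11b_three_of_isX11Three W hX) htam0 hK hdK hHN hP
    (by exact_mod_cast hc) Wd Cd hWd qd hqd hqd0 (j := 2) (by exact_mod_cast hrec)
  exact IsX11Three.bsdp_of_ram_of_not_dvd_of_card_addSubgroup_selmerThree_eq hGZ hKo hB hSk hGZK hmod
    hnf hHL hMaz hNS W hX hram htam0 hS hcardS hq (by exact_mod_cast hv)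

/-- **The LB3+KOLY rows at `p = 3` off the atom (no (ram) prime; `ρ̄_{E,3}` onto displayed):
`ord₃ [E(K):ℤP] ≤ 1` at a Heegner field with `d_K < −4`, the record equation
`2·ord₃ [E(K):ℤP] = 2 + ord₃ q_d + ord₃ ∏c_ℓ(E)`, and EXACT `#Sel^(3)(E/ℚ) = 27` ⇒ `BSD(E,3)`** —
`ClassX11b.bsdp_of_kolyvagin_of_card_selmer` at `p = 3` with `hs`/`hv : ord₃ s = 2` REPLACED by the
record (PUBLISHED binders `hGZ hKo hB hGZK hmod`). Per pair; X11 ∧ `r = 1` ∧ `p = 3` stays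
CONSTRUCTION-SHAPED; nothing booked. [cite: McCallumLMS1991, §1 Theorem (Kolyvagin), p. 296]
[cite: JetchevSkinnerWan2017, §7.4.1 (eq:gz for K′), pp. 29–30] [cite: Miller2011LMS, §1 and Def. 1.1] -/
theorem ClassX11b.bsdp_three_of_kolyvagin_of_card_selmerThree_of_indexRecord
    (hGZ : gross_zagier (W.conductorNorm ℤ) W K) (hKo : kolyvagin (W.conductorNorm ℤ) W K)
    (hB : Kolyvagin1990_padicValNat_card_sha_le (W.conductorNorm ℤ) W K)
    (hGZK : rank_eq_analyticRank_of_analyticRank_le_one) (hmod : hasEntireLFunction_rat)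
    (hX : ClassX11b W 3) (hρ : Surj W 3)
    (hK : IsImaginaryQuadratic K) (hdK : NumberField.discr K < -4)
    (hHN : SatisfiesHeegnerHypothesis (W.conductorNorm ℤ) K)
    (hP : WeierstrassCurve.Affine.Point.map ι.toRatAlgHom P = heegnerPointComplex Dt H)
    (hc : ¬ (3 : ℤ) ∣ Dt.c)
    (Wd : WeierstrassCurve ℚ) [Wd.IsElliptic] [Wd.IsGloballyMinimal] (Cd : VariableChange ℚ)
    (hWd : Cd • W.quadraticTwist (NumberField.discr K : ℚ) = Wd)
    (qd : ℚ) (hqd : Wd.entireLFunction 1 / (Wd.realPeriodRat : ℂ) = (qd : ℂ)) (hqd0 : qd ≠ 0)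
    (hI : padicValNat 3 (AddSubgroup.zmultiples P).index ≤ 1)
    (hrec : 2 * (padicValNat 3 (AddSubgroup.zmultiples P).index : ℤ) =
      2 + padicValRat 3 qd + padicValNat 3 W.tamagawaProduct)
    (hcard : Nat.card (W.selmerGroup (3 : ℤ)) = 27) :
    BSDp W 3 :=
  ClassX11b.bsdp_of_kolyvagin_of_card_selmer_of_indexRecord W 3 K Dt H ι P hGZ hKo hB hGZK hmod hX hρ
    hK hdK hHN hP (by exact_mod_cast hc) Wd Cd hWd qd hqd hqd0 hI hrec
    (by rw [show ((3 : ℕ) : ℤ) = 3 by norm_num, hcard]; norm_num)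

end Three

end Summit.BirchSwinnertonDyer.Rank1Residual.X11b

end
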